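/-
Copyright (c) 2026. All rights reserved.
Released under Apache 2.0 license as described in the file LICENSE.
Authors: abc-iut cell — seat abc-iut-L6-t15 (gen 3): proof-only companion to `HolomorphicCores`
([AbsTopIII] Prop 2.5), no new definitions.
-/
import Literature.AnabelianGeometry.AbsoluteAnabelian.ParallelogramsPlanarBoundary

/-!
# Planar geometry behind [AbsTopIII] Prop 2.5, V: parallel line segments have the same direction

Proof-only companion (no definitions) to `HolomorphicCores.lean`, continuing
`ParallelogramsPlanarBoundary`.  For an open `U ⊆ ℂ` and `𝒮(U) ⊆ 𝒬 ⊆ 𝒫(U)`: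

* the pair of ends `{a, b}` of a non-degenerate closed segment is determined by the segment;
* Prop 2.5 (b): two disjoint sides of a member of `𝒬` are opposite edges, hence STRICTLY PARALLEL line
  segments have proportional direction vectors; inclusion of line segments preserves the direction too, so
  PARALLEL line segments (the equivalence relation generated by inclusion and strict parallelism) have
  proportional direction vectors.

Refereed classical mathematics (S. Mochizuki, *Topics in absolute anabelian geometry III*, §2; kurims
pages); nothing here bears on the disputed parts of IUT.
-/

namespace Literature.AnabelianGeometry.AbsoluteAnabelian

open _root_.Complex _root_.Set _root_.Topology _root_.Filter _root_.Metric

noncomputable section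

/-! ### The ends of a segment are determined by the segment -/

/-- The unordered pair of ends of a non-degenerate closed segment in `ℂ` is determined by the segment (the
ends are the points with connected complement). (Auxiliary.) [cite: MochizukiAbsTopIII2015, Proposition 2.5 (a) p.56] -/
theorem segment_ends_unique {a b c d : ℂ} (hab : a ≠ b) (h : segment ℝ a b = segment ℝ c d) :
    (c = a ∧ d = b) ∨ (c = b ∧ d = a) := by
  have hcd : c ≠ d := by
    rintro rfl
    rw [segment_same] at h
    exact (segment_infinite hab) (h ▸ finite_singleton c)
  have hc : c = a ∨ c = b := (isConnected_segment_diff_singleton_iff hab (h ▸ left_mem_segment ℝ c d)).1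
    (h ▸ (isConnected_segment_diff_singleton_iff hcd (left_mem_segment ℝ c d)).2 (Or.inl rfl))
  have hd : d = a ∨ d = b := (isConnected_segment_diff_singleton_iff hab (h ▸ right_mem_segment ℝ c d)).1
    (h ▸ (isConnected_segment_diff_singleton_iff hcd (right_mem_segment ℝ c d)).2 (Or.inr rfl))
  rcases hc with rfl | rfl <;> rcases hd with rfl | rfl
  · exact (hcd rfl).elim
  · exact Or.inl ⟨rfl, rfl⟩
  · exact Or.inr ⟨rfl, rfl⟩
  · exact (hcd rfl).elim

/-- Direction vectors of equal segments are proportional.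
(Auxiliary.) [cite: MochizukiAbsTopIII2015, Proposition 2.5 (proof) pp.55–57] -/
theorem exists_sub_eq_mul_of_segment_eq {a b c d : ℂ} (hab : a ≠ b) (h : segment ℝ a b = segment ℝ c d) :
    ∃ r : ℝ, d - c = (r : ℂ) * (b - a) := by
  rcases segment_ends_unique hab h with ⟨rfl, rfl⟩ | ⟨rfl, rfl⟩
  · exact ⟨1, by push_cast; ring⟩
  · exact ⟨-1, by push_cast; ring⟩

/-- Direction vectors of nested non-degenerate segments are proportional.
(Auxiliary.) [cite: MochizukiAbsTopIII2015, Proposition 2.5 (proof) pp.55–57] -/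
theorem exists_sub_eq_mul_of_segment_subset {a b c d : ℂ} (hab : a ≠ b)
    (h : segment ℝ a b ⊆ segment ℝ c d) : ∃ r : ℝ, d - c = (r : ℂ) * (b - a) := by
  obtain ⟨σ, τ, hc, hd⟩ := exists_lineMap_eq_of_mem_segment (h (left_mem_segment ℝ a b))
    (h (right_mem_segment ℝ a b)) hab
  exact ⟨τ - σ, by rw [hc, hd, lineMap_apply_complex, lineMap_apply_complex]; push_cast; ring⟩

/-! ### Prop 2.5 (b): disjoint sides are opposite edges; strictly parallel segments -/

/-- A corner `(s, t)` (`s, t ∈ {0,1}`) lies on the horizontal edge at height `t` and the vertical edge at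
abscissa `s`. (Auxiliary.) [cite: MochizukiAbsTopIII2015, Proposition 2.5 (proof) pp.55–57] -/
theorem sq_corner_mem_hv {s t : ℝ} (hs : s = 0 ∨ s = 1) (ht : t = 0 ∨ t = 1) :
    (⟨s, t⟩ : ℂ) ∈ Icc (0 : ℝ) 1 ×ℂ {t} ∩ {s} ×ℂ Icc (0 : ℝ) 1 := by
  simp only [mem_inter_iff, mem_reProdIm, mem_Icc, mem_singleton_iff]
  rcases hs with rfl | rfl <;> rcases ht with rfl | rfl <;> norm_num

/-- A corner `(s, t)` (`s, t ∈ {0,1}`) lies on the vertical edge at abscissa `s` and the horizontal edge at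
height `t`. (Auxiliary.) [cite: MochizukiAbsTopIII2015, Proposition 2.5 (proof) pp.55–57] -/
theorem sq_corner_mem_vh {s t : ℝ} (hs : s = 0 ∨ s = 1) (ht : t = 0 ∨ t = 1) :
    (⟨s, t⟩ : ℂ) ∈ {s} ×ℂ Icc (0 : ℝ) 1 ∩ Icc (0 : ℝ) 1 ×ℂ {t} := by
  rw [inter_comm]; exact sq_corner_mem_hv hs ht

/-- Two disjoint edges of the unit square are both horizontal or both vertical.
(Auxiliary.) [cite: MochizukiAbsTopIII2015, Proposition 2.5 (proof) pp.55–57] -/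
theorem sq_edges_disjoint {E E' : Set ℂ}
    (hE : E = Icc 0 1 ×ℂ {(0 : ℝ)} ∨ E = Icc 0 1 ×ℂ {(1 : ℝ)} ∨ E = {(0 : ℝ)} ×ℂ Icc 0 1 ∨
      E = {(1 : ℝ)} ×ℂ Icc 0 1)
    (hE' : E' = Icc 0 1 ×ℂ {(0 : ℝ)} ∨ E' = Icc 0 1 ×ℂ {(1 : ℝ)} ∨ E' = {(0 : ℝ)} ×ℂ Icc 0 1 ∨
      E' = {(1 : ℝ)} ×ℂ Icc 0 1) (h : E ∩ E' = ∅) :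
    (∃ t t' : ℝ, E = Icc 0 1 ×ℂ {t} ∧ E' = Icc 0 1 ×ℂ {t'}) ∨
      (∃ s s' : ℝ, E = {s} ×ℂ Icc 0 1 ∧ E' = {s'} ×ℂ Icc 0 1) := by
  rw [eq_empty_iff_forall_notMem] at h
  rcases hE with rfl | rfl | rfl | rfl <;> rcases hE' with rfl | rfl | rfl | rfl <;>
    first
    | exact Or.inl ⟨_, _, rfl, rfl⟩
    | exact Or.inr ⟨_, _, rfl, rfl⟩
    | exact (h _ (sq_corner_mem_hv (by norm_num) (by norm_num))).elim
    | exact (h _ (sq_corner_mem_vh (by norm_num) (by norm_num))).elim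

/-- **Prop 2.5 (b)**: strictly parallel line segments of `(U, 𝒬)` (`𝒮(U) ⊆ 𝒬 ⊆ 𝒫(U)`) — containing two
non-intersecting sides of a member of `𝒬` — have proportional direction vectors.
[cite: MochizukiAbsTopIII2015, Proposition 2.5 (b) p.56] -/
theorem Parallelograms.StrictlyParallel.exists_sub_eq_mul {U : Set ℂ} (hU : IsOpen U) {𝒬 : Set (Set U)}
    (h𝒬 : ∀ Q ∈ 𝒬, Subtype.val '' Q ∈ parallelogramsIn U)
    (h𝒮 : ∀ Q : Set U, Subtype.val '' Q ∈ squaresIn U → Q ∈ 𝒬) {M M' : Set U}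
    (hMM' : Parallelograms.StrictlyParallel 𝒬 M M') {a b a' b' : ℂ} (hab : a ≠ b)
    (hM : Subtype.val '' M = segment ℝ a b) (hM' : Subtype.val '' M' = segment ℝ a' b') :
    ∃ r : ℝ, b' - a' = (r : ℂ) * (b - a) := by
  obtain ⟨Q, hQ, S, S', hS, hS', hSS', hSM, hS'M'⟩ := hMM'
  obtain ⟨z, v, w, hvw, hQe, hcl⟩ := h𝒬 Q hQ
  rw [hQe] at hcl
  obtain ⟨A, hA⟩ := exists_homeomorph_frame z v w hvw
  have hv : v ≠ 0 := by simpa using hvw.ne_zero 0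
  have hw : w ≠ 0 := by simpa using hvw.ne_zero 1
  obtain ⟨E, hE, rfl⟩ := (Parallelograms.isSide_iff_of_subset hU h𝒬 h𝒮 hQ hQe hvw hcl hA).1 hS
  obtain ⟨E', hE', rfl⟩ := (Parallelograms.isSide_iff_of_subset hU h𝒬 h𝒮 hQ hQe hvw hcl hA).1 hS'
  have hEU : ∀ {F : Set ℂ}, (F = Icc 0 1 ×ℂ {(0 : ℝ)} ∨ F = Icc 0 1 ×ℂ {(1 : ℝ)} ∨
      F = {(0 : ℝ)} ×ℂ Icc 0 1 ∨ F = {(1 : ℝ)} ×ℂ Icc 0 1) → A '' F ⊆ U := fun hF =>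
    (image_mono (sq_edge_subset_boundary hF)).trans
      ((closure_diff_openParallelogram_eq_image hvw hA).symm.le.trans (sdiff_subset.trans hcl))
  have himE : ∀ {F : Set ℂ}, A '' F ⊆ U → Subtype.val '' (Subtype.val ⁻¹' (A '' F) : Set U) = A '' F :=
    fun hF => by rw [image_preimage_eq_inter_range, Subtype.range_coe, inter_eq_left.2 hF]
  -- the two edges are disjoint, hence both horizontal or both vertical
  have hdisj : E ∩ E' = ∅ := by
    have := congrArg (fun T : Set U => Subtype.val '' T) hSS'
    simp only [image_empty] at this
    rw [image_inter Subtype.val_injective, himE (hEU hE), himE (hEU hE'), ← image_inter A.injective,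
      image_eq_empty] at this
    exact this
  -- direction vectors of `M ⊇ S` and `M' ⊇ S'`
  have hdir : ∀ {F : Set ℂ} {N : Set U} {c d p u : ℂ}, A '' F ⊆ U → A '' F = segment ℝ p (p + u) →
      u ≠ 0 → (Subtype.val ⁻¹' (A '' F) : Set U) ⊆ N → Subtype.val '' N = segment ℝ c d →
      ∃ r : ℝ, d - c = (r : ℂ) * u := by
    intro F N c d p u hFU hF hu hFN hN
    have h1 : segment ℝ p (p + u) ⊆ segment ℝ c d := by
      rw [← hF, ← hN, ← himE hFU]
      exact image_mono hFN
    obtain ⟨r, hr⟩ := exists_sub_eq_mul_of_segment_subset (by simpa using hu) h1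
    exact ⟨r, by rw [hr]; ring⟩
  rcases sq_edges_disjoint hE hE' hdisj with ⟨t, t', rfl, rfl⟩ | ⟨s, s', rfl, rfl⟩
  · obtain ⟨r₁, hr₁⟩ := hdir (hEU hE) (image_frame_Icc_const hA t) hv hSM hM
    obtain ⟨r₂, hr₂⟩ := hdir (hEU hE') (image_frame_Icc_const hA t') hv hS'M' hM'
    have hr₁0 : (r₁ : ℂ) ≠ 0 := by
      intro h0; apply hab; rw [h0, zero_mul, sub_eq_zero] at hr₁; exact hr₁.symm
    refine ⟨r₂ / r₁, ?_⟩
    rw [hr₂, hr₁]; push_cast; field_simp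
  · obtain ⟨r₁, hr₁⟩ := hdir (hEU hE) (image_frame_const_Icc hA s) hw hSM hM
    obtain ⟨r₂, hr₂⟩ := hdir (hEU hE') (image_frame_const_Icc hA s') hw hS'M' hM'
    have hr₁0 : (r₁ : ℂ) ≠ 0 := by
      intro h0; apply hab; rw [h0, zero_mul, sub_eq_zero] at hr₁; exact hr₁.symm
    refine ⟨r₂ / r₁, ?_⟩
    rw [hr₂, hr₁]; push_cast; field_simp

/-! ### Prop 2.5 (b): parallel line segments have proportional directions -/

/-- **Prop 2.5 (b)**: PARALLEL line segments of `(U, 𝒬)` (`𝒮(U) ⊆ 𝒬 ⊆ 𝒫(U)`) — equivalent under the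
equivalence relation generated by inclusion and strict parallelism — have proportional direction vectors.
(The equivalence relation "equal, or both non-degenerate segments with proportional directions" contains
the generating relation.) [cite: MochizukiAbsTopIII2015, Proposition 2.5 (b) p.56] -/
theorem Parallelograms.Parallel.exists_sub_eq_mul {U : Set ℂ} (hU : IsOpen U) {𝒬 : Set (Set U)}
    (h𝒬 : ∀ Q ∈ 𝒬, Subtype.val '' Q ∈ parallelogramsIn U)
    (h𝒮 : ∀ Q : Set U, Subtype.val '' Q ∈ squaresIn U → Q ∈ 𝒬) {M M' : Set U}
    (hMM' : Parallelograms.Parallel 𝒬 M M') {a b a' b' : ℂ} (hab : a ≠ b)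
    (hM : Subtype.val '' M = segment ℝ a b) (hM' : Subtype.val '' M' = segment ℝ a' b') :
    ∃ r : ℝ, b' - a' = (r : ℂ) * (b - a) := by
  obtain ⟨-, -, hgen⟩ := hMM'
  -- auxiliary equivalence relation containing the generating relation
  let R' : Set U → Set U → Prop := fun N N' => N = N' ∨
    ∃ (c d c' d' : ℂ) (r : ℝ), c ≠ d ∧ c' ≠ d' ∧ Subtype.val '' N = segment ℝ c d ∧
      Subtype.val '' N' = segment ℝ c' d' ∧ d' - c' = (r : ℂ) * (d - c)
  have hequiv : Equivalence R' := by
    refine ⟨fun N => Or.inl rfl, ?_, ?_⟩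
    · rintro N N' (h | ⟨c, d, c', d', r, hcd, hc'd', hN, hN', hr⟩)
      · exact Or.inl h.symm
      · have hr0 : (r : ℂ) ≠ 0 := by
          intro h0; apply hc'd'; rw [h0, zero_mul, sub_eq_zero] at hr; exact hr.symm
        refine Or.inr ⟨c', d', c, d, r⁻¹, hc'd', hcd, hN', hN, ?_⟩
        rw [hr]; push_cast; field_simp
    · rintro N N' N'' (h₁ | ⟨c, d, c', d', r, hcd, hc'd', hN, hN', hr⟩)
        (h₂ | ⟨e, f, e', f', r', hef, he'f', hN'₂, hN'', hr'⟩)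
      · exact h₁ ▸ h₂ ▸ Or.inl rfl
      · subst h₁; exact Or.inr ⟨e, f, e', f', r', hef, he'f', hN'₂, hN'', hr'⟩
      · subst h₂; exact Or.inr ⟨c, d, c', d', r, hcd, hc'd', hN, hN', hr⟩
      · obtain ⟨ρ, hρ⟩ := exists_sub_eq_mul_of_segment_eq hc'd' (hN'.symm.trans hN'₂)
        refine Or.inr ⟨c, d, e', f', r' * ρ * r, hcd, he'f', hN, hN'', ?_⟩
        rw [hr', hρ, hr]; push_cast; ring
  have hRR' : (fun N N' : Set U => Parallelograms.IsLineSegment 𝒬 N ∧ Parallelograms.IsLineSegment 𝒬 N' ∧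
      (N ⊆ N' ∨ Parallelograms.StrictlyParallel 𝒬 N N')) ≤ R' := by
    rintro N N' ⟨hN, hN', h⟩
    obtain ⟨c, d, hcd, hNe⟩ := hN.exists_eq_segment_of_subset hU h𝒬 h𝒮
    obtain ⟨c', d', hc'd', hN'e⟩ := hN'.exists_eq_segment_of_subset hU h𝒬 h𝒮
    rcases h with h | h
    · obtain ⟨r, hr⟩ := exists_sub_eq_mul_of_segment_subset hcd (hNe ▸ hN'e ▸ image_mono h)
      exact Or.inr ⟨c, d, c', d', r, hcd, hc'd', hNe, hN'e, hr⟩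
    · obtain ⟨r, hr⟩ := h.exists_sub_eq_mul hU h𝒬 h𝒮 hcd hNe hN'e
      exact Or.inr ⟨c, d, c', d', r, hcd, hc'd', hNe, hN'e, hr⟩
  rcases (hequiv.eqvGen_iff).1 (Relation.EqvGen.mono hRR' M M' hgen) with
    h | ⟨c, d, c', d', r, hcd, hc'd', hN, hN', hr⟩
  · subst h
    exact exists_sub_eq_mul_of_segment_eq hab (hM.symm.trans hM')
  · obtain ⟨ρ₁, hρ₁⟩ := exists_sub_eq_mul_of_segment_eq hab (hM.symm.trans hN)
    obtain ⟨ρ₂, hρ₂⟩ := exists_sub_eq_mul_of_segment_eq hc'd' (hN'.symm.trans hM')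
    exact ⟨ρ₂ * r * ρ₁, by rw [hρ₂, hr, hρ₁]; push_cast; ring⟩

end

end Literature.AnabelianGeometry.AbsoluteAnabelian
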